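import Literature.AlgebraicGeometry.Resolution.MonoidalEFReduction
import HarnessLib

/-!
# [CoP1] Prop. 8.1: the reduction `E = F` WITHIN a subring carrying the archimedean comparability

Topic: `Literature/AlgebraicGeometry/Resolution` (proofs only; no new notions, no new named
facts). `MonoidalEFReduction.lean` proves the `E = F` reduction of [CoP1] Prop. 8.1 (Cossart–Piltant
2008, proof of Prop. 8.1, HAL p. 23) under a GLOBAL archimedean hypothesis `harch` (rank one). In
Cossart–Piltant 2019's descent (proof of journal Prop. 4.8, Lemma 4.7: "it is not necessary to
assume here that `dim 𝒪_v̂ = 1` because `h ∈ A`") the valuation `v̂` may have higher rank; what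
holds (`ArithmeticalThreefoldsCompletionValues{,Iso}.lean`) is the comparability
`∃ n, v̂(y)ⁿ ≤ v̂(f)` for the elements `y` of positive value of a SUBRING `locAtCentre C O`
(`C = Â[1/h]`) containing `f⁻¹`, hence stable under the loop's monoidal transforms (every
parameter blown up divides `f`). This file re-runs the three statements of
`MonoidalEFReduction.lean` WITHIN such a subring, proofs verbatim with the invariant
`S[t] ⊆ locAtCentre C O` threaded (`exists_frameStep_measure_lt_within`,
`exists_frameSteps_measure_lt_within`, `exists_frameSteps_supp_eq_within`); the bound for the
pair `(x_{i₁}, x_{i₂})` is `v(x_{i₂})ⁿ ≤ v(f) ≤ v(x_{i₁})` (`x_{i₁} ∣ f`).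

## Sources

* V. Cossart, O. Piltant, J. Algebra 320 (2008) 1051–1082: proof of Prop. 8.1 (HAL
  hal-00139124, pp. 22–23). [CossartPiltant2008]
* V. Cossart, O. Piltant, J. Algebra 529 (2019) 268–535 = arXiv:1412.0868, proof of Prop. 4.8
  with Lemma 4.7 (arXiv v1: Prop. 4.6, p. 53). [CossartPiltant2019]
-/

noncomputable section

namespace Literature.AlgebraicGeometry.Resolution

universe u

open IsLocalRing _root_.Polynomial

section EFReductionWithin

variable {S : Type u} [CommRing S] [IsDomain S] [IsLocalRing S] {E : Type u} [Field E]
  [Algebra S E] [Algebra.IsAlgebraic S E]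
  (hSuc : IsUniversallyCatenaryRing S) (hinj : Function.Injective (algebraMap S E))
  (O : ValuationSubring E) (hSO : ∀ s : S, algebraMap S E s ∈ O)
  (hdom : ∀ s ∈ maximalIdeal S, O.valuation (algebraMap S E s) < 1)
  (hres : ∀ y : O, ∃ q : S[X], (∃ i, q.coeff i ∉ maximalIdeal S) ∧
    O.valuation (q.eval₂ (algebraMap S E) y) < 1)
  {d : ℕ} (hSdim : ringKrullDim S = d)

omit [IsDomain S] [IsLocalRing S] [Algebra.IsAlgebraic S E] in
/-- `x_i⁻¹ = (f/x_i) · f⁻¹ ∈ L` for a monomial `f = u ∏ x_c^{α_c}` with `α_i > 0`. [folklore] -/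
private theorem inv_mem_of_eq_mul_prod_pow {R L : Subring E} (hRL : R ≤ L) {f u : E} (huR : u ∈ R)
    (x : Fin d → R) (α : Fin d → ℕ) (hf : f = u * ∏ c, (x c : E) ^ α c) (hf0 : f ≠ 0)
    (hfL : f⁻¹ ∈ L) (i : Fin d) (hαi : 0 < α i) : ((x i : E))⁻¹ ∈ L := by
  classical
  set r : E := u * (x i : E) ^ (α i - 1) * ∏ c ∈ Finset.univ.erase i, (x c : E) ^ α c with hrdef
  have hprod : (∏ c, (x c : E) ^ α c) =
      (x i : E) ^ α i * ∏ c ∈ Finset.univ.erase i, (x c : E) ^ α c :=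
    (Finset.mul_prod_erase Finset.univ (fun c => (x c : E) ^ α c) (Finset.mem_univ i)).symm
  have hpow : (x i : E) ^ α i = (x i : E) ^ (α i - 1) * (x i : E) := by
    rw [← pow_succ, Nat.sub_add_cancel hαi]
  have hr : f = (x i : E) * r := by
    rw [hf, hprod, hpow, hrdef]; ring
  have hxi0 : (x i : E) ≠ 0 := fun h0 => hf0 (by rw [hr, h0, zero_mul])
  have hrR : r ∈ R :=
    Subring.mul_mem _ (Subring.mul_mem _ huR (Subring.pow_mem _ (x i).2 _))
      (prod_mem fun c _ => Subring.pow_mem _ (x c).2 _)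
  have key : ((x i : E))⁻¹ = r * f⁻¹ := by
    rw [hr, mul_inv, ← mul_assoc, mul_comm r, mul_assoc, mul_inv_cancel₀ ?_, mul_one]
    exact fun h0 => hf0 (by rw [hr, h0, mul_zero])
  rw [key]
  exact Subring.mul_mem _ (hRL hrR) hfL

omit [IsDomain S] [IsLocalRing S] [Algebra.IsAlgebraic S E] in
/-- `v(f) ≤ v(x_i)` for a monomial `f = u ∏ x_c^{α_c}` in `O` with `α_i > 0`. [folklore] -/
private theorem valuation_le_of_eq_mul_prod_pow {R : Subring E} (hRO : R ≤ O.toSubring) {f u : E}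
    (huR : u ∈ R) (x : Fin d → R) (α : Fin d → ℕ) (hf : f = u * ∏ c, (x c : E) ^ α c)
    (i : Fin d) (hαi : 0 < α i) : O.valuation f ≤ O.valuation (x i : E) := by
  classical
  set r : E := u * (x i : E) ^ (α i - 1) * ∏ c ∈ Finset.univ.erase i, (x c : E) ^ α c with hrdef
  have hprod : (∏ c, (x c : E) ^ α c) =
      (x i : E) ^ α i * ∏ c ∈ Finset.univ.erase i, (x c : E) ^ α c :=
    (Finset.mul_prod_erase Finset.univ (fun c => (x c : E) ^ α c) (Finset.mem_univ i)).symm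
  have hpow : (x i : E) ^ α i = (x i : E) ^ (α i - 1) * (x i : E) := by
    rw [← pow_succ, Nat.sub_add_cancel hαi]
  have hr : f = (x i : E) * r := by
    rw [hf, hprod, hpow, hrdef]; ring
  have hrR : r ∈ R :=
    Subring.mul_mem _ (Subring.mul_mem _ huR (Subring.pow_mem _ (x i).2 _))
      (prod_mem fun c _ => Subring.pow_mem _ (x c).2 _)
  have hr1 : O.valuation r ≤ 1 := (O.valuation_le_one_iff _).mpr (hRO hrR)
  rw [hr, map_mul]
  exact mul_le_of_le_one_right' hr1

omit [IsDomain S] [IsLocalRing S] [Algebra.IsAlgebraic S E] in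
/-- `S[t ∪ {z}] ⊆ locAtCentre C O` from `S[t] ⊆ locAtCentre C O ∋ z`. [folklore] -/
private theorem adjoin_insert_le_locAtCentre {C : Subring E} {t : Set E}
    (htC : (Algebra.adjoin S t).toSubring ≤ locAtCentre C O) {z : E}
    (hz : z ∈ locAtCentre C O) :
    (Algebra.adjoin S (insert z t)).toSubring ≤ locAtCentre C O := by
  let L' : Subalgebra S E :=
    { locAtCentre C O with
      algebraMap_mem' := fun s => htC ((Algebra.adjoin S t).algebraMap_mem s) }
  have h : Algebra.adjoin S (insert z t) ≤ L' := by
    rw [Algebra.adjoin_le_iff]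
    rintro y (rfl | hy)
    · exact hz
    · exact htC (Algebra.subset_adjoin hy)
  intro y hy
  exact h hy

set_option maxHeartbeats 1600000 in
include hSuc hinj hSO hdom hres hSdim in
/-- **One step of the `E = F` reduction, within `locAtCentre C O`** (`exists_frameStep_measure_lt`
with the invariant; `x_{i₂}/x_{i₁} ∈ locAtCentre C O` as `x_{i₁} ∣ f`). [cite: CossartPiltant2008, proof of Prop. 8.1 (HAL p. 23)] -/
theorem exists_frameStep_measure_lt_within
    (t : Set E) (ht : t.Finite) (hTO : (Algebra.adjoin S t).toSubring ≤ O.toSubring)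
    (hreg : IsRegularLocalRing (locAtCentre (Algebra.adjoin S t).toSubring O))
    (x : Fin d → locAtCentre (Algebra.adjoin S t).toSubring O)
    (hx : haveI := isLocalRing_locAtCentre hTO
      Ideal.span (Set.range x) = maximalIdeal _)
    (f h u w : E) (huR : u ∈ locAtCentre (Algebra.adjoin S t).toSubring O)
    (hvu : O.valuation u = 1) (hwR : w ∈ locAtCentre (Algebra.adjoin S t).toSubring O)
    (hvw : O.valuation w = 1) (α β : Fin d → ℕ)
    (hf : f = u * ∏ c, (x c : E) ^ α c) (hh : h = w * ∏ c, (x c : E) ^ β c)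
    (hFE : ∀ c, 0 < β c → 0 < α c) (i₁ i₂ : Fin d) (hα₁ : 0 < α i₁) (hβ₁ : β i₁ = 0)
    (hβ₂ : 0 < β i₂) (hle : O.valuation (x i₂ : E) ≤ O.valuation (x i₁ : E))
    (C : Subring E) (htC : (Algebra.adjoin S t).toSubring ≤ locAtCentre C O) (hf0 : f ≠ 0)
    (hfC : f⁻¹ ∈ locAtCentre C O) :
    ∃ (t' : Set E), t ⊆ t' ∧ t'.Finite ∧ (Algebra.adjoin S t').toSubring ≤ locAtCentre C O ∧
      ∃ (hT'O : (Algebra.adjoin S t').toSubring ≤ O.toSubring),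
        IsRegularLocalRing (locAtCentre (Algebra.adjoin S t').toSubring O) ∧
        ∃ (x' : Fin d → locAtCentre (Algebra.adjoin S t').toSubring O) (u' w' : E)
          (α' β' : Fin d → ℕ),
          (haveI := isLocalRing_locAtCentre hT'O
           Ideal.span (Set.range x') = maximalIdeal _) ∧
          u' ∈ locAtCentre (Algebra.adjoin S t').toSubring O ∧ O.valuation u' = 1 ∧
          w' ∈ locAtCentre (Algebra.adjoin S t').toSubring O ∧ O.valuation w' = 1 ∧
          f = u' * ∏ c, (x' c : E) ^ α' c ∧ h = w' * ∏ c, (x' c : E) ^ β' c ∧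
          (∀ c, 0 < β' c → 0 < α' c) ∧ (∃ c, 0 < β' c) ∧
          (Finset.univ.filter (fun c => 0 < α' c ∧ β' c = 0)).card <
            (Finset.univ.filter (fun c => 0 < α c ∧ β c = 0)).card := by
  classical
  have h12 : i₁ ≠ i₂ := by rintro rfl; exact (Nat.lt_irrefl 0) (hβ₁ ▸ hβ₂)
  set z : E := (x i₂ : E) / (x i₁ : E) with hzdef
  -- the new generator stays in `locAtCentre C O`
  have hRC : locAtCentre (Algebra.adjoin S t).toSubring O ≤ locAtCentre C O :=
    (locAtCentre_mono O htC).trans (locAtCentre_locAtCentre C O).le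
  have hzC : z ∈ locAtCentre C O := by
    rw [hzdef, div_eq_mul_inv]
    exact Subring.mul_mem _ (hRC (x i₂).2)
      (inv_mem_of_eq_mul_prod_pow hRC huR x α hf hf0 hfC i₁ hα₁)
  have hinsC : (Algebra.adjoin S (insert z t)).toSubring ≤ locAtCentre C O :=
    adjoin_insert_le_locAtCentre O htC hzC
  -- the old measure set contains `i₁`
  have hi₁mem : i₁ ∈ Finset.univ.filter (fun c => 0 < α c ∧ β c = 0) :=
    Finset.mem_filter.mpr ⟨Finset.mem_univ _, hα₁, hβ₁⟩
  have hzle : O.valuation z ≤ 1 := by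
    by_cases h0 : (x i₁ : E) = 0
    · rw [hzdef, h0, div_zero, map_zero]; exact zero_le_one
    · rw [hzdef, map_div₀]; exact div_le_one_of_le₀ hle zero_le
  rcases hzle.lt_or_eq with hlt | h1
  · /- `v(z) > 0`: `z` is a new regular parameter, `i₁` enters `F` -/
    obtain ⟨hT₁O, hreg₁, x', hx'c, hx'b, hspan, hmono⟩ :=
      exists_frameStep_of_valuation_lt_one hSuc hinj O hSO hdom hres hSdim t ht hTO hreg x hx
        i₁ i₂ h12 hlt
    have hsub : locAtCentre (Algebra.adjoin S t).toSubring O ≤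
        locAtCentre (Algebra.adjoin S (insert z t)).toSubring O :=
      locAtCentre_mono O (fun y hy => Algebra.adjoin_mono (Set.subset_insert _ _) hy)
    refine ⟨insert z t, Set.subset_insert _ _, ht.insert z, hinsC, hT₁O, hreg₁, x', u, w,
      Function.update α i₁ (α i₁ + α i₂), Function.update β i₁ (β i₁ + β i₂), hspan,
      hsub huR, hvu, hsub hwR, hvw, ?_, ?_, fun c hc => ?_, ⟨i₁, ?_⟩, ?_⟩
    · rw [hf, hmono α]
    · rw [hh, hmono β]
    · by_cases hc1 : c = i₁
      · subst hc1
        rw [Function.update_self]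
        exact Nat.add_pos_left hα₁ _
      · rw [Function.update_of_ne hc1] at hc ⊢
        exact hFE c hc
    · rw [Function.update_self, hβ₁, zero_add]; exact hβ₂
    · refine Finset.card_lt_card ⟨fun c hc => ?_, fun hsub' => ?_⟩
      · obtain ⟨-, hαc, hβc⟩ := Finset.mem_filter.mp hc
        have hc1 : c ≠ i₁ := by
          rintro rfl
          rw [Function.update_self, hβ₁, zero_add] at hβc
          exact absurd hβc (Nat.pos_iff_ne_zero.mp hβ₂)
        rw [Function.update_of_ne hc1] at hαc hβc
        exact Finset.mem_filter.mpr ⟨Finset.mem_univ _, hαc, hβc⟩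
      · have hb : Function.update β i₁ (β i₁ + β i₂) i₁ = 0 :=
          (Finset.mem_filter.mp (hsub' hi₁mem)).2.2
        rw [Function.update_self, hβ₁, zero_add] at hb
        exact absurd hb (Nat.pos_iff_ne_zero.mp hβ₂)
  · /- `v(z) = 0`: `z` is a unit, `i₂` leaves `E` and `F`, `i₁` enters `F` -/
    obtain ⟨hT₁O, hreg₁, hunit, x', hx'c, hspan, hmono⟩ :=
      exists_frameStep_of_valuation_eq_one hSuc hinj O hSO hdom hres hSdim t ht hTO hreg x hx
        i₁ i₂ h12 h1
    have hsub : locAtCentre (Algebra.adjoin S t).toSubring O ≤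
        locAtCentre (Algebra.adjoin S (insert z t)).toSubring O :=
      locAtCentre_mono O (fun y hy => Algebra.adjoin_mono (Set.subset_insert _ _) hy)
    have hzR : z ∈ locAtCentre (Algebra.adjoin S (insert z t)).toSubring O :=
      le_locAtCentre _ _ (Algebra.subset_adjoin (Set.mem_insert _ _))
    refine ⟨insert z t, Set.subset_insert _ _, ht.insert z, hinsC, hT₁O, hreg₁, x',
      u * z ^ α i₂, w * z ^ β i₂,
      Function.update (Function.update α i₁ (α i₁ + α i₂)) i₂ 0,
      Function.update (Function.update β i₁ (β i₁ + β i₂)) i₂ 0, hspan,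
      Subring.mul_mem _ (hsub huR) (Subring.pow_mem _ hzR _), ?_,
      Subring.mul_mem _ (hsub hwR) (Subring.pow_mem _ hzR _), ?_, ?_, ?_,
      fun c hc => ?_, ⟨i₁, ?_⟩, ?_⟩
    · rw [map_mul, map_pow, hvu, h1, one_pow, one_mul]
    · rw [map_mul, map_pow, hvw, h1, one_pow, one_mul]
    · rw [hf, hmono α, mul_assoc]
    · rw [hh, hmono β, mul_assoc]
    · by_cases hc2 : c = i₂
      · subst hc2; rw [Function.update_self] at hc; exact absurd hc (Nat.lt_irrefl 0)
      · rw [Function.update_of_ne hc2] at hc ⊢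
        by_cases hc1 : c = i₁
        · subst hc1
          rw [Function.update_self]
          exact Nat.add_pos_left hα₁ _
        · rw [Function.update_of_ne hc1] at hc ⊢
          exact hFE c hc
    · rw [Function.update_of_ne h12, Function.update_self, hβ₁, zero_add]; exact hβ₂
    · refine Finset.card_lt_card ⟨fun c hc => ?_, fun hsub' => ?_⟩
      · obtain ⟨-, hαc, hβc⟩ := Finset.mem_filter.mp hc
        have hc2 : c ≠ i₂ := by
          rintro rfl
          rw [Function.update_self] at hαc
          exact (Nat.lt_irrefl 0) hαc
        rw [Function.update_of_ne hc2] at hαc hβc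
        have hc1 : c ≠ i₁ := by
          rintro rfl
          rw [Function.update_self, hβ₁, zero_add] at hβc
          exact absurd hβc (Nat.pos_iff_ne_zero.mp hβ₂)
        rw [Function.update_of_ne hc1] at hαc hβc
        exact Finset.mem_filter.mpr ⟨Finset.mem_univ _, hαc, hβc⟩
      · have hb : Function.update (Function.update β i₁ (β i₁ + β i₂)) i₂ 0 i₁ = 0 :=
          (Finset.mem_filter.mp (hsub' hi₁mem)).2.2
        rw [Function.update_of_ne h12, Function.update_self, hβ₁, zero_add] at hb
        exact absurd hb (Nat.pos_iff_ne_zero.mp hβ₂)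

set_option maxHeartbeats 1600000 in
include hSuc hinj hSO hdom hres hSdim in
/-- **"After iterating `n` times", within `locAtCentre C O`.** [cite: CossartPiltant2008, proof of Prop. 8.1 (HAL p. 23)] -/
theorem exists_frameSteps_measure_lt_within (n : ℕ) :
    ∀ (t : Set E) (_ : t.Finite) (hTO : (Algebra.adjoin S t).toSubring ≤ O.toSubring)
      (_ : IsRegularLocalRing (locAtCentre (Algebra.adjoin S t).toSubring O))
      (x : Fin d → locAtCentre (Algebra.adjoin S t).toSubring O)
      (_ : haveI := isLocalRing_locAtCentre hTO
        Ideal.span (Set.range x) = maximalIdeal _)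
      (f h u w : E) (_ : u ∈ locAtCentre (Algebra.adjoin S t).toSubring O)
      (_ : O.valuation u = 1) (_ : w ∈ locAtCentre (Algebra.adjoin S t).toSubring O)
      (_ : O.valuation w = 1) (α β : Fin d → ℕ)
      (_ : f = u * ∏ c, (x c : E) ^ α c) (_ : h = w * ∏ c, (x c : E) ^ β c)
      (_ : ∀ c, 0 < β c → 0 < α c) (i₁ i₂ : Fin d) (_ : 0 < α i₁) (_ : β i₁ = 0)
      (_ : 0 < β i₂) (_ : O.valuation (x i₂ : E) ^ n ≤ O.valuation (x i₁ : E))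
      (C : Subring E) (_ : (Algebra.adjoin S t).toSubring ≤ locAtCentre C O) (_ : f ≠ 0)
      (_ : f⁻¹ ∈ locAtCentre C O),
    ∃ (t' : Set E), t ⊆ t' ∧ t'.Finite ∧ (Algebra.adjoin S t').toSubring ≤ locAtCentre C O ∧
      ∃ (hT'O : (Algebra.adjoin S t').toSubring ≤ O.toSubring),
        IsRegularLocalRing (locAtCentre (Algebra.adjoin S t').toSubring O) ∧
        ∃ (x' : Fin d → locAtCentre (Algebra.adjoin S t').toSubring O) (u' w' : E)
          (α' β' : Fin d → ℕ),
          (haveI := isLocalRing_locAtCentre hT'O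
           Ideal.span (Set.range x') = maximalIdeal _) ∧
          u' ∈ locAtCentre (Algebra.adjoin S t').toSubring O ∧ O.valuation u' = 1 ∧
          w' ∈ locAtCentre (Algebra.adjoin S t').toSubring O ∧ O.valuation w' = 1 ∧
          f = u' * ∏ c, (x' c : E) ^ α' c ∧ h = w' * ∏ c, (x' c : E) ^ β' c ∧
          (∀ c, 0 < β' c → 0 < α' c) ∧ (∃ c, 0 < β' c) ∧
          (Finset.univ.filter (fun c => 0 < α' c ∧ β' c = 0)).card <
            (Finset.univ.filter (fun c => 0 < α c ∧ β c = 0)).card := by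
  classical
  induction n with
  | zero =>
    intro t ht hTO hreg x hx f h u w huR hvu hwR hvw α β hf hh hFE i₁ i₂ hα₁ hβ₁ hβ₂ hn C htC hf0 hfC
    -- `1 ≤ v(x_{i₁}) < 1`: impossible
    exfalso
    haveI := isLocalRing_locAtCentre hTO
    have hlt : O.valuation (x i₁ : E) < 1 :=
      (mem_maximalIdeal_locAtCentre_iff hTO _).mp (hx ▸ Ideal.subset_span ⟨i₁, rfl⟩)
    rw [pow_zero] at hn
    exact (lt_irrefl _) (lt_of_le_of_lt hn hlt)
  | succ k ih =>
    intro t ht hTO hreg x hx f h u w huR hvu hwR hvw α β hf hh hFE i₁ i₂ hα₁ hβ₁ hβ₂ hn C htC hf0 hfC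
    by_cases hle : O.valuation (x i₂ : E) ≤ O.valuation (x i₁ : E)
    · exact exists_frameStep_measure_lt_within hSuc hinj O hSO hdom hres hSdim t ht hTO hreg x hx f
        h u w huR hvu hwR hvw α β hf hh hFE i₁ i₂ hα₁ hβ₁ hβ₂ hle C htC hf0 hfC
    · -- `W y_{i₂} < W y_{i₁}`: transform at `(x_{i₂}, x_{i₁})`, chart `z = x_{i₁}/x_{i₂}`
      have h12 : i₁ ≠ i₂ := by rintro rfl; exact (Nat.lt_irrefl 0) (hβ₁ ▸ hβ₂)
      have hlt' : O.valuation (x i₁ : E) < O.valuation (x i₂ : E) := lt_of_not_ge hle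
      haveI := isLocalRing_locAtCentre hTO
      have hx2m : O.valuation (x i₂ : E) < 1 :=
        (mem_maximalIdeal_locAtCentre_iff hTO _).mp (hx ▸ Ideal.subset_span ⟨i₂, rfl⟩)
      have hx2ne : O.valuation (x i₂ : E) ≠ 0 := by
        intro h0
        rw [h0] at hlt'
        exact not_lt_of_ge zero_le hlt'
      have hzlt : O.valuation ((x i₁ : E) / (x i₂ : E)) < 1 := by
        rw [map_div₀, div_lt_one₀ (zero_lt_iff.mpr hx2ne)]
        exact hlt'
      set z : E := (x i₁ : E) / (x i₂ : E) with hzdef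
      have hRC : locAtCentre (Algebra.adjoin S t).toSubring O ≤ locAtCentre C O :=
        (locAtCentre_mono O htC).trans (locAtCentre_locAtCentre C O).le
      have hzC : z ∈ locAtCentre C O := by
        rw [hzdef, div_eq_mul_inv]
        exact Subring.mul_mem _ (hRC (x i₁).2)
          (inv_mem_of_eq_mul_prod_pow hRC huR x α hf hf0 hfC i₂ (hFE i₂ hβ₂))
      have hinsC : (Algebra.adjoin S (insert z t)).toSubring ≤ locAtCentre C O :=
        adjoin_insert_le_locAtCentre O htC hzC
      obtain ⟨hT₁O, hreg₁, x', hx'c, hx'b, hspan, hmono⟩ :=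
        exists_frameStep_of_valuation_lt_one hSuc hinj O hSO hdom hres hSdim t ht hTO hreg x hx
          i₂ i₁ h12.symm hzlt
      have hsub : locAtCentre (Algebra.adjoin S t).toSubring O ≤
          locAtCentre (Algebra.adjoin S (insert z t)).toSubring O :=
        locAtCentre_mono O (fun y hy => Algebra.adjoin_mono (Set.subset_insert _ _) hy)
      -- the new state has the same `E`, `F`, and a smaller archimedean bound
      have hn' : O.valuation (x' i₂ : E) ^ k ≤ O.valuation (x' i₁ : E) := by
        rw [hx'c i₂ h12.symm, hx'b, map_div₀, le_div_iff₀ (zero_lt_iff.mpr hx2ne), ← pow_succ]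
        exact hn
      obtain ⟨t', htt', ht', ht'C, hT'O, hreg', x'', u', w', α', β', hspan', hu'R, hvu', hw'R,
        hvw', hf', hh', hFE', hF', hcard⟩ :=
        ih (insert z t) (ht.insert z) hT₁O hreg₁ x' hspan f h u w (hsub huR) hvu (hsub hwR) hvw
          (Function.update α i₂ (α i₂ + α i₁)) (Function.update β i₂ (β i₂ + β i₁))
          (by rw [hf, hmono α]) (by rw [hh, hmono β])
          (fun c hc => by
            by_cases hc2 : c = i₂
            · subst hc2; rw [Function.update_self]; exact Nat.add_pos_left (hFE _ hβ₂) _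
            · rw [Function.update_of_ne hc2] at hc ⊢; exact hFE c hc)
          i₁ i₂ (by rw [Function.update_of_ne h12]; exact hα₁)
          (by rw [Function.update_of_ne h12]; exact hβ₁)
          (by rw [Function.update_self]; exact Nat.add_pos_left hβ₂ _) hn' C hinsC hf0 hfC
      refine ⟨t', (Set.subset_insert _ _).trans htt', ht', ht'C, hT'O, hreg', x'', u', w', α', β',
        hspan', hu'R, hvu', hw'R, hvw', hf', hh', hFE', hF', lt_of_lt_of_le hcard (le_of_eq ?_)⟩
      -- the measure set is unchanged by this step
      congr 1
      ext c
      simp only [Finset.mem_filter, Finset.mem_univ, true_and]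
      by_cases hc2 : c = i₂
      · subst hc2
        rw [Function.update_self, Function.update_self]
        constructor
        · rintro ⟨-, h0⟩; exact absurd h0 (Nat.ne_of_gt (Nat.add_pos_left hβ₂ _))
        · rintro ⟨-, h0⟩; exact absurd h0 (Nat.ne_of_gt hβ₂)
      · rw [Function.update_of_ne hc2, Function.update_of_ne hc2]

set_option maxHeartbeats 1600000 in
include hSuc hinj hSO hdom hres hSdim in
/-- **[CoP1] Prop. 8.1, the reduction to `E = F`, from the comparability on `locAtCentre C O` only**
(`harch` of `exists_frameSteps_supp_eq` replaced by `∀ y ∈ locAtCentre C O, v(y) < 1 → ∃ n, v(y)ⁿ ≤ v(f)`;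
for higher-rank `v̂` with `C = Â[1/h]`, fed by `exists_pow_valuation_le_of_mul_pow_eq`).
[cite: CossartPiltant2008, proof of Prop. 8.1 (HAL p. 23)] [cite: CossartPiltant2019, proof of Prop. 4.8 with Lemma 4.7] -/
theorem exists_frameSteps_supp_eq_within (m : ℕ) :
    ∀ (t : Set E) (_ : t.Finite) (hTO : (Algebra.adjoin S t).toSubring ≤ O.toSubring)
      (_ : IsRegularLocalRing (locAtCentre (Algebra.adjoin S t).toSubring O))
      (x : Fin d → locAtCentre (Algebra.adjoin S t).toSubring O)
      (_ : haveI := isLocalRing_locAtCentre hTO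
        Ideal.span (Set.range x) = maximalIdeal _)
      (f h u w : E) (_ : u ∈ locAtCentre (Algebra.adjoin S t).toSubring O)
      (_ : O.valuation u = 1) (_ : w ∈ locAtCentre (Algebra.adjoin S t).toSubring O)
      (_ : O.valuation w = 1) (α β : Fin d → ℕ)
      (_ : f = u * ∏ c, (x c : E) ^ α c) (_ : h = w * ∏ c, (x c : E) ^ β c)
      (_ : ∀ c, 0 < β c → 0 < α c) (_ : ∃ c, 0 < β c)
      (_ : (Finset.univ.filter (fun c => 0 < α c ∧ β c = 0)).card ≤ m)
      (C : Subring E) (_ : (Algebra.adjoin S t).toSubring ≤ locAtCentre C O) (_ : f ≠ 0)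
      (_ : f⁻¹ ∈ locAtCentre C O)
      (_ : ∀ y ∈ locAtCentre C O, O.valuation y < 1 → ∃ n : ℕ, O.valuation y ^ n ≤ O.valuation f),
    ∃ (t' : Set E), t ⊆ t' ∧ t'.Finite ∧ (Algebra.adjoin S t').toSubring ≤ locAtCentre C O ∧
      ∃ (hT'O : (Algebra.adjoin S t').toSubring ≤ O.toSubring),
        IsRegularLocalRing (locAtCentre (Algebra.adjoin S t').toSubring O) ∧
        ∃ (x' : Fin d → locAtCentre (Algebra.adjoin S t').toSubring O) (u' w' : E)
          (α' β' : Fin d → ℕ),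
          (haveI := isLocalRing_locAtCentre hT'O
           Ideal.span (Set.range x') = maximalIdeal _) ∧
          u' ∈ locAtCentre (Algebra.adjoin S t').toSubring O ∧ O.valuation u' = 1 ∧
          w' ∈ locAtCentre (Algebra.adjoin S t').toSubring O ∧ O.valuation w' = 1 ∧
          f = u' * ∏ c, (x' c : E) ^ α' c ∧ h = w' * ∏ c, (x' c : E) ^ β' c ∧
          (∀ c, 0 < α' c ↔ 0 < β' c) := by
  classical
  induction m with
  | zero =>
    intro t ht hTO hreg x hx f h u w huR hvu hwR hvw α β hf hh hFE hF hm C htC hf0 hfC harchC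
    refine ⟨t, le_rfl, ht, htC, hTO, hreg, x, u, w, α, β, hx, huR, hvu, hwR, hvw, hf, hh,
      fun c => ⟨fun hαc => ?_, hFE c⟩⟩
    by_contra hβc
    have : c ∈ Finset.univ.filter (fun c => 0 < α c ∧ β c = 0) :=
      Finset.mem_filter.mpr ⟨Finset.mem_univ _, hαc, Nat.eq_zero_of_not_pos hβc⟩
    rw [Nat.le_zero, Finset.card_eq_zero] at hm
    rw [hm] at this
    exact absurd this (Finset.notMem_empty _)
  | succ k ih =>
    intro t ht hTO hreg x hx f h u w huR hvu hwR hvw α β hf hh hFE hF hm C htC hf0 hfC harchC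
    by_cases h0 : (Finset.univ.filter (fun c => 0 < α c ∧ β c = 0)).card = 0
    · exact ih t ht hTO hreg x hx f h u w huR hvu hwR hvw α β hf hh hFE hF (h0.trans_le (Nat.zero_le _))
        C htC hf0 hfC harchC
    · -- pick `i₁ ∈ E ∖ F`, `i₂ ∈ F`, and the archimedean bound
      obtain ⟨i₁, hi₁⟩ := Finset.card_pos.mp (Nat.pos_of_ne_zero h0)
      obtain ⟨-, hα₁, hβ₁⟩ := Finset.mem_filter.mp hi₁
      obtain ⟨i₂, hβ₂⟩ := hF
      haveI := isLocalRing_locAtCentre hTO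
      have hx2m : O.valuation (x i₂ : E) < 1 :=
        (mem_maximalIdeal_locAtCentre_iff hTO _).mp (hx ▸ Ideal.subset_span ⟨i₂, rfl⟩)
      have hRC : locAtCentre (Algebra.adjoin S t).toSubring O ≤ locAtCentre C O :=
        (locAtCentre_mono O htC).trans (locAtCentre_locAtCentre C O).le
      obtain ⟨n, hn0⟩ := harchC (x i₂ : E) (hRC (x i₂).2) hx2m
      have hn : O.valuation (x i₂ : E) ^ n ≤ O.valuation (x i₁ : E) :=
        hn0.trans (valuation_le_of_eq_mul_prod_pow O (locAtCentre_le hTO) huR x α hf i₁ hα₁)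
      obtain ⟨t', htt', ht', ht'C, hT'O, hreg', x', u', w', α', β', hspan', hu'R, hvu', hw'R, hvw',
        hf', hh', hFE', hF', hcard⟩ :=
        exists_frameSteps_measure_lt_within hSuc hinj O hSO hdom hres hSdim n t ht hTO hreg x hx f h
          u w huR hvu hwR hvw α β hf hh hFE i₁ i₂ hα₁ hβ₁ hβ₂ hn C htC hf0 hfC
      obtain ⟨t'', ht't'', ht'', ht''C, hT''O, hreg'', x'', u'', w'', α'', β'', hspan'', hu''R,
        hvu'', hw''R, hvw'', hf'', hh'', hiff⟩ :=
        ih t' ht' hT'O hreg' x' hspan' f h u' w' hu'R hvu' hw'R hvw' α' β' hf' hh' hFE' hF'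
          (Nat.le_of_lt_succ (lt_of_lt_of_le hcard hm)) C ht'C hf0 hfC harchC
      exact ⟨t'', htt'.trans ht't'', ht'', ht''C, hT''O, hreg'', x'', u'', w'', α'', β'', hspan'',
        hu''R, hvu'', hw''R, hvw'', hf'', hh'', hiff⟩

end EFReductionWithin

end Literature.AlgebraicGeometry.Resolution

end
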